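/-
Copyright (c) 2026 the pub-hodgecm-mathlib formalisation cell (harness21).  Prover seat hodgecm-mathlib-A-p19 (g25): T3′ seam organ Σ2-CM «THE PLACE
DICTIONARY» (road «S3-tree», crux H413), over ★ Σ2-F (p845928) and the tree's quadratic-place dictionary.
-/
import Literature.NumberTheory.Automorphic.SplitTorusOrderComposedIndex              -- ★ O8a-5Σ p846159 (F0P3-p02): `relIndex_units_adjoin_comap_norm_eq` (brings ★ Σ2-F p845928, heads (a)–(d))
import Literature.NumberTheory.Automorphic.UnitaryGroupIntegralPointsReductionInert   -- ★ `mem_integer_galAdicCompletionMap`, `residueHom_galAdicCompletionMap_eq_pow`, `natCard_residueField_eq_sq_of_inert`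
import Literature.NumberTheory.Automorphic.UnitaryGroupInertPlaceHyperbolicBasis     -- ★ `exists_toPlace_eq_of_galAdicCompletionMap_eq`, `galAdicCompletionMap_galAdicCompletionMap_of_smul_eq`
import Literature.NumberTheory.Automorphic.QuadraticAdeleBaseChange                  -- ★ `valued_toPlace_le_one_iff`
import Literature.NumberTheory.Automorphic.ValuedFieldValuativeRelBridge             -- ★ `v_le_one_iff_mem_integer`, `v_eq_one_iff_valuation_eq_one`
import Literature.LinearAlgebra.Matrix.FiniteFieldHermitianAnisotropic               -- ★ `exists_frob_ne`
import HarnessLib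

/-!
# The split-torus order at a non-split place: the dictionary `ι_w : F_v → E_w`, `σ_w` of the unit-index seam

Topic `NumberTheory/Automorphic`; namespace `Literature.NumberTheory.Automorphic`.  THEOREMS ONLY (no definition, no instance, no notation, no named
fact, no `sorry`); kernel lane `--supports stmt-HodgeConjecture-24833` (road «S3-tree», T3′ «DEPTH-ZERO κ-TRANSFER» seam, organ Σ2-CM).

★ Σ2-F (`SplitTorusOrderFixedSide`) and the composed unit index (O8a-5Σ) are typed in the two-field `ValuativeRel` currency `ι : F →+* E`,
`ιO : 𝒪[F] →+* 𝒪[E]`, `σ : E →+* E` with DICTIONARY BINDERS `hιO hιinj hιm hfixO hσι hσσ hσO hmove h2 δ hδ hσδ hq`.  This file discharges every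
one of them at a place: `F_v := v.adicCompletion F`, `E_w := w.1.adicCompletion E` of a quadratic extension `E ∕ F` of number fields with
non-trivial automorphism `c`, at a place `w ∣ v` fixed by `c` (non-split), `ι := UnitaryGroup.toPlace v w`, `σ := galAdicCompletionMap c hw` — both integer
rings in the `ValuativeRel` presentation of the tree (`instValuativeRelAdicCompletion`), as in ★ `UnitaryGroupIntegralPointsReductionInert` §3 and
the O8b files.  The CM case is the instance `F := L⁺`, `c := complexConj`.

**Contents.**
* §1 the structure map on integers: `toPlace_mem_integer_iff` (`ι_w y ∈ 𝒪[E_w] ↔ y ∈ 𝒪[F_v]`), `exists_integer_ringHom_toPlace` (an `ιO` with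
  `↑(ιO x) = ι_w x`), and for ANY such `ιO`: `injective_of_coe_eq_toPlace` (`hιinj`), `mem_maximalIdeal_of_map_mem_maximalIdeal` (`hιm`, for every
  ring map of local rings), `exists_map_eq_of_galAdicCompletionMap_eq` (`hfixO`: a `σ_w`-fixed integer is an `ι_w`-image of an integer).
* §2 the involution: `exists_isUnit_galAdicCompletionMap_sub` (`hmove` at an INERT place: `σ_w` moves an integer by a unit — the generic-`c` cut of
  ★ `exists_integer_involution_of_isUnramifiedIn`), `exists_skew_unit_galAdicCompletionMap` (`δ ∈ 𝒪[E_w]^×`, `σ_w δ = −δ`),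
  `natCard_residueField_eq_natCard_residueField_sq` (`hq : |𝓀[E_w]| = |𝓀[F_v]|²`); `h2` from the tame token `|2|_w = 1` of the END contract is
  ★ `Rogawski1990.isUnit_two_integer_iff_valued_eq_one` (a file-local copy of its `←` direction is used in §3–§4).  (`hσι`, `hσσ`, `hσO` are ★ `galAdicCompletionMap_toPlace`, ★ `galAdicCompletionMap_galAdicCompletionMap_of_smul_eq`,
  ★ `mem_integer_galAdicCompletionMap` VERBATIM.)
* §3 the seam at the place: ★ Σ2-F (c) and (d) with every dictionary binder discharged (`index_comap_adjoin_sq_place`,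
  `relIndex_comap_norm_eq_index_units_fixedSide_place`).
* §4 the composed unit index at the place: `natCard_residueField_eq_absNorm` (`|𝓀[F_v]| = N(v)`) and ★ O8a-5Σ with the dictionary discharged,
  **`relIndex_units_adjoin_comap_norm_eq_place`**: `[C : R^×] = (N(v) + 1)^{n−1} · N(v)^{S − (n−1)}` for deep regular `σ_w`-stable nodes
  `γ ∈ 𝒪[E_w]ⁿ` at an inert place `w ∣ v` away from `2` — binders left: the place (`hc hunr hw`, `|2|_w = 1`), any `ιO` over `ι_w`, the nodes.

HONEST LABEL: HC_CM is proved only modulo the 2 remaining named inputs (hLiu418 24832, h413 24833) until rung 0 closes; this file is count-neutral.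

## References
* [Serre1979] J.-P. Serre, *Local Fields*, GTM 67 (1979), Ch. II §1–§3; Ch. V §2 Prop. 3 and its Corollary (`U_K = N(U_L)` at an unramified
  quadratic extension; the residue automorphism is the Frobenius).
* [Neukirch1999] J. Neukirch, *Algebraic Number Theory* (1999), Ch. II §4 Prop. (4.3), §6 (completions of an extension, `e(w|v) f(w|v)`).
* [CasselsFrohlichANT1967] J. W. S. Cassels, A. Fröhlich (eds.), *Algebraic Number Theory* (1967), Ch. II §10, Ch. VII §1.1 (`E ⊗_F F_v`,
  the decomposition group acting on `E_w`).
* [Rogawski1990] J. D. Rogawski, *Automorphic Representations of Unitary Groups in Three Variables* (1990), §4.9 p. 54–56 (where the index is used).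
-/

set_option autoImplicit false

noncomputable section

open ValuativeRel NumberField IsDedekindDomain
open scoped ValuativeRel

namespace Literature.NumberTheory.Automorphic

open UnitaryGroup

/-! ## §1 The structure map `ι_w` on integers -/

section Place

variable {F E : Type} [Field F] [NumberField F] [Field E] [NumberField E] [Algebra F E]
  (v : HeightOneSpectrum (𝓞 F)) (w : UnitaryGroup.PlacesOver E v)

/-- **`ι_w y ∈ 𝒪[E_w] ↔ y ∈ 𝒪[F_v]`** (`|ι_w y|_w = |y|_v^{e(w|v)}`, `e ≥ 1`; ★ `valued_toPlace_le_one_iff` in the `ValuativeRel` presentation of both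
integer rings). [cite: Neukirch1999, Ch. II §4 Prop. (4.3)] -/
theorem toPlace_mem_integer_iff (y : v.adicCompletion F) :
    UnitaryGroup.toPlace v w y ∈ 𝒪[w.1.adicCompletion E] ↔ y ∈ 𝒪[v.adicCompletion F] := by
  rw [← v_le_one_iff_mem_integer, ← v_le_one_iff_mem_integer]
  exact valued_toPlace_le_one_iff w y

/-- **THE INTEGER STRUCTURE MAP `ιO : 𝒪[F_v] →+* 𝒪[E_w]`** with `↑(ιO x) = ι_w x` (the binder `(ιO, hιO)` of ★ Σ2-F). [cite: Neukirch1999, Ch. II §4] -/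
theorem exists_integer_ringHom_toPlace :
    ∃ ιO : 𝒪[v.adicCompletion F] →+* 𝒪[w.1.adicCompletion E],
      ∀ x : 𝒪[v.adicCompletion F], ((ιO x : 𝒪[w.1.adicCompletion E]) : w.1.adicCompletion E) = UnitaryGroup.toPlace v w x :=
  ⟨((UnitaryGroup.toPlace v w).comp (𝒪[v.adicCompletion F]).subtype).codRestrict 𝒪[w.1.adicCompletion E]
      fun x => (toPlace_mem_integer_iff v w (x : v.adicCompletion F)).2 x.2,
    fun _ => rfl⟩

/-- `hιinj`: any `ιO` over `ι_w` is injective (`ι_w` is a field map). [cite: Neukirch1999, Ch. II §4] -/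
theorem injective_of_coe_eq_toPlace (ιO : 𝒪[v.adicCompletion F] →+* 𝒪[w.1.adicCompletion E])
    (hιO : ∀ x : 𝒪[v.adicCompletion F], ((ιO x : 𝒪[w.1.adicCompletion E]) : w.1.adicCompletion E) = UnitaryGroup.toPlace v w x) :
    Function.Injective ιO := fun x y hxy =>
  Subtype.ext ((UnitaryGroup.toPlace v w).injective (by rw [← hιO x, ← hιO y, hxy]))

/-- `hιm`: **a ring map of local rings pulls the maximal ideal back into the maximal ideal** (units go to units). [cite: Serre1979, Ch. II §1] -/
theorem mem_maximalIdeal_of_map_mem_maximalIdeal {R S : Type*} [CommRing R] [IsLocalRing R] [CommRing S] [IsLocalRing S] (f : R →+* S)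
    (x : R) (hx : f x ∈ IsLocalRing.maximalIdeal S) : x ∈ IsLocalRing.maximalIdeal R :=
  IsLocalRing.le_maximalIdeal (Ideal.comap_ne_top f (IsLocalRing.maximalIdeal.isMaximal S).ne_top) (Ideal.mem_comap.2 hx)

variable [Algebra.IsQuadraticExtension F E] (c : E ≃ₐ[F] E)

/-- `hfixO`: **a `σ_w`-fixed integer of `E_w` is the `ι_w`-image of an integer of `F_v`** (`w` non-split: the fixed field of `σ_w = c ⊗ 1` on
`E_w = E ⊗_F F_v` is `ι_w(F_v)`, ★ `exists_toPlace_eq_of_galAdicCompletionMap_eq`; integrality by `toPlace_mem_integer_iff`).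
[cite: CasselsFrohlichANT1967, Ch. II §10] [cite: Neukirch1999, Ch. II §4 Prop. (4.3)] -/
theorem exists_map_eq_of_galAdicCompletionMap_eq (hc : c ≠ 1) (hw : c • w.1 = w.1)
    (ιO : 𝒪[v.adicCompletion F] →+* 𝒪[w.1.adicCompletion E])
    (hιO : ∀ x : 𝒪[v.adicCompletion F], ((ιO x : 𝒪[w.1.adicCompletion E]) : w.1.adicCompletion E) = UnitaryGroup.toPlace v w x)
    (y : 𝒪[w.1.adicCompletion E]) (hy : galAdicCompletionMap (L := E) c hw (y : w.1.adicCompletion E) = y) :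
    ∃ x : 𝒪[v.adicCompletion F], ιO x = y := by
  obtain ⟨p, hp⟩ := exists_toPlace_eq_of_galAdicCompletionMap_eq c w hc hw (y : w.1.adicCompletion E) hy
  have hpO : p ∈ 𝒪[v.adicCompletion F] := (toPlace_mem_integer_iff v w p).1 (hp ▸ y.2)
  exact ⟨⟨p, hpO⟩, Subtype.ext (by rw [hιO, hp])⟩

end Place

/-! ## §2 The involution `σ_w` at an inert place: a moved integer, a skew unit, `q_w = q_v²`, `2 ∈ 𝒪^×` -/

section Conj

variable {F E : Type} [Field F] [NumberField F] [Field E] [NumberField E] [Algebra F E]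
  [Algebra.IsQuadraticExtension F E] (c : E ≃ₐ[F] E) (v : HeightOneSpectrum (𝓞 F))

/-- `hmove`: **at an INERT place `σ_w` moves some integer by a unit** (`v` unramified in `E`, `w ∣ v`, `c • w = w`, `c ≠ 1`): the reduction of `σ_w`
is the `q_v`-Frobenius of `𝓀[E_w] = 𝔽_{q_v²}` (★ `residueHom_galAdicCompletionMap_eq_pow`), which is not the identity (★ `exists_frob_ne`); lift a moved
residue (★ `exists_isUnit_map_sub_of_residueHom_ne`).  The generic-`c` cut of ★ `exists_integer_involution_of_isUnramifiedIn`, in the `hmove` shape of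
★ Σ2-F (d). [cite: Serre1979, Ch. V §2, proof of Prop. 3] -/
theorem exists_isUnit_galAdicCompletionMap_sub (hc : c ≠ 1) (hunr : Algebra.IsUnramifiedIn (𝓞 E) v.asIdeal) (w : UnitaryGroup.PlacesOver E v)
    (hw : c • w.1 = w.1) :
    ∃ a : 𝒪[w.1.adicCompletion E],
      IsUnit ((⟨galAdicCompletionMap (L := E) c hw a, mem_integer_galAdicCompletionMap c v w hw a⟩ : 𝒪[w.1.adicCompletion E]) - a) := by
  classical
  obtain ⟨σk, hσk⟩ := exists_residueField_ringHom_galAdicCompletionMap c v w hw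
  have hq : Nat.card 𝓀[w.1.adicCompletion E] = Nat.card (𝓞 F ⧸ v.asIdeal) ^ 2 := natCard_residueField_eq_sq_of_inert c v hc hunr w hw
  letI : Fintype 𝓀[w.1.adicCompletion E] := Fintype.ofFinite _
  have hq' : Fintype.card 𝓀[w.1.adicCompletion E] = Nat.card (𝓞 F ⧸ v.asIdeal) ^ 2 := by rw [← Nat.card_eq_fintype_card, hq]
  exact LocalFields.UnramifiedQuadraticNorm.exists_isUnit_map_sub_of_residueHom_ne (galAdicCompletionMap (L := E) c hw)
    (mem_integer_galAdicCompletionMap c v w hw) σk hσk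
    (Literature.LinearAlgebra.Matrix.exists_frob_ne hq' σk (residueHom_galAdicCompletionMap_eq_pow c v hc hunr w hw σk
      (mem_integer_galAdicCompletionMap c v w hw) hσk))

/-- `δ, hδ, hσδ`: **a SKEW UNIT at an inert place** — `δ ∈ 𝒪[E_w]^×` with `σ_w δ = −δ` (`δ := σ_w a − a` for the moved integer `a`, `σ_w² = 1`).
[cite: Serre1979, Ch. V §2 Prop. 3] -/
theorem exists_skew_unit_galAdicCompletionMap (hc : c ≠ 1) (hunr : Algebra.IsUnramifiedIn (𝓞 E) v.asIdeal) (w : UnitaryGroup.PlacesOver E v)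
    (hw : c • w.1 = w.1) :
    ∃ δ : 𝒪[w.1.adicCompletion E], IsUnit δ ∧
      galAdicCompletionMap (L := E) c hw (δ : w.1.adicCompletion E) = -(δ : w.1.adicCompletion E) := by
  obtain ⟨a, ha⟩ := exists_isUnit_galAdicCompletionMap_sub c v hc hunr w hw
  refine ⟨_, ha, ?_⟩
  have hcoe : (((⟨galAdicCompletionMap (L := E) c hw a, mem_integer_galAdicCompletionMap c v w hw a⟩ : 𝒪[w.1.adicCompletion E]) - a :
      𝒪[w.1.adicCompletion E]) : w.1.adicCompletion E) = galAdicCompletionMap (L := E) c hw a - a := rfl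
  rw [hcoe, map_sub, galAdicCompletionMap_galAdicCompletionMap_of_smul_eq c w hc hw, neg_sub]

/-- `hq`: **`|𝓀[E_w]| = |𝓀[F_v]|²` at an inert place** (★ `natCard_residueField_eq_sq_of_inert`, ★ `natCard_residueField_valuativeRel_eq`).
[cite: Neukirch1999, Ch. II §4 Prop. (4.3)] -/
theorem natCard_residueField_eq_natCard_residueField_sq (hc : c ≠ 1) (hunr : Algebra.IsUnramifiedIn (𝓞 E) v.asIdeal) (w : UnitaryGroup.PlacesOver E v)
    (hw : c • w.1 = w.1) :
    Nat.card 𝓀[w.1.adicCompletion E] = Nat.card 𝓀[v.adicCompletion F] ^ 2 := by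
  rw [natCard_residueField_eq_sq_of_inert c v hc hunr w hw, natCard_residueField_valuativeRel_eq v]

omit [Algebra.IsQuadraticExtension F E] in
/-- `h2`: **`2 ∈ 𝒪[E_w]^×` from the tame token `|2|_w = 1`** of the END contract — the `←` direction of ★
`Rogawski1990.isUnit_two_integer_iff_valued_eq_one` (`UnitFundamentalLemmaInertFlickerFrame`), kept file-local here so the seam does not import the
Flicker-frame file; consumers outside this file use the ★ iff. [cite: Serre1979, Ch. II §1] -/
private theorem isUnit_two_integer_of_valued_eq_one (u : HeightOneSpectrum (𝓞 E)) (h2 : Valued.v (2 : u.adicCompletion E) = 1) :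
    IsUnit (2 : 𝒪[u.adicCompletion E]) := by
  rw [(Valuation.integer.integers (valuation (u.adicCompletion E))).isUnit_iff_valuation_eq_one]
  change valuation (u.adicCompletion E) (((2 : 𝒪[u.adicCompletion E]) : u.adicCompletion E)) = 1
  have e2 : ((2 : 𝒪[u.adicCompletion E]) : u.adicCompletion E) = 2 := map_ofNat (𝒪[u.adicCompletion E]).subtype 2
  rw [e2, ← v_eq_one_iff_valuation_eq_one, h2]

end Conj

/-! ## §3 The seam at the place: ★ Σ2-F (c), (d) with the dictionary discharged -/

section Seam

variable {F E : Type} [Field F] [NumberField F] [Field E] [NumberField E] [Algebra F E]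
  [Algebra.IsQuadraticExtension F E] (c : E ≃ₐ[F] E) (v : HeightOneSpectrum (𝓞 F)) {n : ℕ}

/-- **Σ2-F (c) AT AN INERT PLACE AWAY FROM 2**: `[𝒪_vⁿ : RF]² = [𝒪_wⁿ : R]` for the order `R = 𝒪_w[γ]` of a `σ_w`-stable `γ ∈ E_wⁿ` and its
`F_v`-side `RF` (pull-back along any `ιO` over `ι_w`) — ★ `index_comap_adjoin_sq` with `hιO hfixO hσι hσσ hσO h2 δ hδ hσδ` discharged by §1–§2.
[cite: Serre1979, Ch. V §2 Prop. 3] [cite: Neukirch1999, Ch. I §12] -/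
theorem index_comap_adjoin_sq_place (hc : c ≠ 1) (hunr : Algebra.IsUnramifiedIn (𝓞 E) v.asIdeal) (w : UnitaryGroup.PlacesOver E v)
    (hw : c • w.1 = w.1) (h2 : Valued.v (2 : w.1.adicCompletion E) = 1)
    (ιO : 𝒪[v.adicCompletion F] →+* 𝒪[w.1.adicCompletion E])
    (hιO : ∀ x : 𝒪[v.adicCompletion F], ((ιO x : 𝒪[w.1.adicCompletion E]) : w.1.adicCompletion E) = UnitaryGroup.toPlace v w x)
    (γ : Fin n → w.1.adicCompletion E)
    (hσγ : ∀ x ∈ Algebra.adjoin 𝒪[w.1.adicCompletion E] ({γ} : Set (Fin n → w.1.adicCompletion E)),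
      (fun i => galAdicCompletionMap (L := E) c hw (x i)) ∈ Algebra.adjoin 𝒪[w.1.adicCompletion E] ({γ} : Set (Fin n → w.1.adicCompletion E))) :
    ((Algebra.adjoin 𝒪[w.1.adicCompletion E] ({γ} : Set (Fin n → w.1.adicCompletion E))).toSubring.comap
        (RingHom.pi fun i : Fin n => ((𝒪[w.1.adicCompletion E]).subtype.comp ιO).comp
          (Pi.evalRingHom (fun _ : Fin n => 𝒪[v.adicCompletion F]) i))).toAddSubgroup.index ^ 2 =
      ((Algebra.adjoin 𝒪[w.1.adicCompletion E] ({γ} : Set (Fin n → w.1.adicCompletion E))).toSubring.comap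
        (RingHom.pi fun i : Fin n => (𝒪[w.1.adicCompletion E]).subtype.comp
          (Pi.evalRingHom (fun _ : Fin n => 𝒪[w.1.adicCompletion E]) i))).toAddSubgroup.index := by
  obtain ⟨δ, hδ, hσδ⟩ := exists_skew_unit_galAdicCompletionMap c v hc hunr w hw
  exact index_comap_adjoin_sq (UnitaryGroup.toPlace v w) ιO (galAdicCompletionMap (L := E) c hw) hιO
    (exists_map_eq_of_galAdicCompletionMap_eq v w c hc hw ιO hιO) (galAdicCompletionMap_toPlace c w w hw)
    (galAdicCompletionMap_galAdicCompletionMap_of_smul_eq c w hc hw) (fun a ha => mem_integer_galAdicCompletionMap c v w hw ⟨a, ha⟩)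
    (isUnit_two_integer_of_valued_eq_one w.1 h2) δ hδ hσδ γ hσγ

/-- **Σ2-F (d) AT AN INERT PLACE**: the norm-fibre index `C.relIndex G = [(𝒪_v^×)ⁿ : RF^×]` in O8a-1's tokens at `E_w`, `σ_w` — ★
`relIndex_comap_norm_eq_index_units_fixedSide` with `hιO hιinj hfixO hσι hσσ hσO hmove` discharged by §1–§2. [cite: Serre1979, Ch. V §2 Prop. 3, Corollary] -/
theorem relIndex_comap_norm_eq_index_units_fixedSide_place (hc : c ≠ 1) (hunr : Algebra.IsUnramifiedIn (𝓞 E) v.asIdeal)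
    (w : UnitaryGroup.PlacesOver E v) (hw : c • w.1 = w.1)
    (ιO : 𝒪[v.adicCompletion F] →+* 𝒪[w.1.adicCompletion E])
    (hιO : ∀ x : 𝒪[v.adicCompletion F], ((ιO x : 𝒪[w.1.adicCompletion E]) : w.1.adicCompletion E) = UnitaryGroup.toPlace v w x)
    (γ : Fin n → w.1.adicCompletion E) :
    (((Algebra.adjoin 𝒪[w.1.adicCompletion E] ({γ} : Set (Fin n → w.1.adicCompletion E))).toSubmonoid.units).comap
        (MonoidHom.id (Fin n → w.1.adicCompletion E)ˣ *
          (Units.map (RingHom.pi fun i : Fin n => (galAdicCompletionMap (L := E) c hw).comp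
            (Pi.evalRingHom (fun _ : Fin n => w.1.adicCompletion E) i)).toMonoidHom))).relIndex
        (Units.map (RingHom.pi fun i : Fin n => (𝒪[w.1.adicCompletion E]).subtype.comp
          (Pi.evalRingHom (fun _ : Fin n => 𝒪[w.1.adicCompletion E]) i)).toMonoidHom).range =
      (Units.map ((Algebra.adjoin 𝒪[w.1.adicCompletion E] ({γ} : Set (Fin n → w.1.adicCompletion E))).toSubring.comap
        (RingHom.pi fun i : Fin n => ((𝒪[w.1.adicCompletion E]).subtype.comp ιO).comp
          (Pi.evalRingHom (fun _ : Fin n => 𝒪[v.adicCompletion F]) i))).subtype.toMonoidHom).range.index :=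
  relIndex_comap_norm_eq_index_units_fixedSide (UnitaryGroup.toPlace v w) ιO (galAdicCompletionMap (L := E) c hw) hιO
    (injective_of_coe_eq_toPlace v w ιO hιO) (exists_map_eq_of_galAdicCompletionMap_eq v w c hc hw ιO hιO)
    (galAdicCompletionMap_toPlace c w w hw) (galAdicCompletionMap_galAdicCompletionMap_of_smul_eq c w hc hw)
    (mem_integer_galAdicCompletionMap c v w hw) (exists_isUnit_galAdicCompletionMap_sub c v hc hunr w hw) γ

end Seam

/-! ## §4 The composed unit index at the place (★ O8a-5Σ with the dictionary discharged) -/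

section Composed

variable {F E : Type} [Field F] [NumberField F] [Field E] [NumberField E] [Algebra F E]
  [Algebra.IsQuadraticExtension F E] (c : E ≃ₐ[F] E) (v : HeightOneSpectrum (𝓞 F)) {n : ℕ}

omit [NumberField E] [Algebra F E] [Algebra.IsQuadraticExtension F E] in
/-- **`|𝓀[F_v]| = N(v)`** in the `ValuativeRel` presentation (★ `natCard_residueField_valuativeRel_eq`; Flicker's `q` is `Ideal.absNorm v.asIdeal` in the ★ unit-FL
counts). [cite: Neukirch1999, Ch. II §4 Prop. (4.3)] -/
theorem natCard_residueField_eq_absNorm : Nat.card 𝓀[v.adicCompletion F] = Ideal.absNorm v.asIdeal := by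
  rw [natCard_residueField_valuativeRel_eq v, Ideal.absNorm_apply, Submodule.cardQuot_apply]

open Finset in
/-- **THE COMPOSED UNIT INDEX AT AN INERT PLACE AWAY FROM 2** (ROW-2 value of the depth-zero κ-transfer, type (1)): for deep regular nodes
`γ ∈ 𝒪[E_w]ⁿ` (`|γ_j − γ_i|_w = |ϖ|_w^{N i j}`, `N i j ≥ 1`) with `𝒪_w[γ]` stable under `σ_w`, in O8a-1's tokens `R^× := (adjoin 𝒪[E_w] {γ}).toSubmonoid.units`,
`C := R^×.comap (id · σ_w)`: `[C : R^×] = (N(v) + 1)^{n−1} · N(v)^{Σ_{i<j} N i j − (n−1)}` — ★ `relIndex_units_adjoin_comap_norm_eq` at `F_v ⊂ E_w`, `ι_w`,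
`σ_w`, with `hιO … hq` discharged by §1–§2 and `q = |𝓀[F_v]| = N(v)`. [cite: Rogawski1990, §4.9 Lemma 4.9.3 p. 56] [cite: Serre1979, Ch. V §2 Prop. 3] -/
theorem relIndex_units_adjoin_comap_norm_eq_place (hc : c ≠ 1) (hunr : Algebra.IsUnramifiedIn (𝓞 E) v.asIdeal)
    (w : UnitaryGroup.PlacesOver E v) (hw : c • w.1 = w.1) (h2 : Valued.v (2 : w.1.adicCompletion E) = 1)
    (ιO : 𝒪[v.adicCompletion F] →+* 𝒪[w.1.adicCompletion E])
    (hιO : ∀ x : 𝒪[v.adicCompletion F], ((ιO x : 𝒪[w.1.adicCompletion E]) : w.1.adicCompletion E) = UnitaryGroup.toPlace v w x)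
    {ϖE : w.1.adicCompletion E} (hϖE : IsUniformizingElement ϖE) (hn : 0 < n) (γ : Fin n → 𝒪[w.1.adicCompletion E])
    (N : Fin n → Fin n → ℕ) (hNpos : ∀ i j : Fin n, i < j → 0 < N i j)
    (hN : ∀ i j : Fin n, i < j →
      valuation (w.1.adicCompletion E) ((γ j : w.1.adicCompletion E) - γ i) = valuation (w.1.adicCompletion E) ϖE ^ N i j)
    (hσγ : ∀ x ∈ Algebra.adjoin 𝒪[w.1.adicCompletion E] ({fun i => (γ i : w.1.adicCompletion E)} : Set (Fin n → w.1.adicCompletion E)),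
      (fun i => galAdicCompletionMap (L := E) c hw (x i)) ∈
        Algebra.adjoin 𝒪[w.1.adicCompletion E] ({fun i => (γ i : w.1.adicCompletion E)} : Set (Fin n → w.1.adicCompletion E))) :
    ((Algebra.adjoin 𝒪[w.1.adicCompletion E] ({fun i => (γ i : w.1.adicCompletion E)} : Set (Fin n → w.1.adicCompletion E))).toSubmonoid.units).relIndex
        (((Algebra.adjoin 𝒪[w.1.adicCompletion E]
            ({fun i => (γ i : w.1.adicCompletion E)} : Set (Fin n → w.1.adicCompletion E))).toSubmonoid.units).comap
          (MonoidHom.id (Fin n → w.1.adicCompletion E)ˣ *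
            (Units.map (RingHom.pi fun i : Fin n => (galAdicCompletionMap (L := E) c hw).comp
              (Pi.evalRingHom (fun _ : Fin n => w.1.adicCompletion E) i)).toMonoidHom))) =
      (Ideal.absNorm v.asIdeal + 1) ^ (n - 1) * Ideal.absNorm v.asIdeal ^ ((∑ i : Fin n, ∑ j ∈ Ioi i, N i j) - (n - 1)) := by
  obtain ⟨δ, hδ, hσδ⟩ := exists_skew_unit_galAdicCompletionMap c v hc hunr w hw
  rw [← natCard_residueField_eq_absNorm v]
  exact relIndex_units_adjoin_comap_norm_eq (UnitaryGroup.toPlace v w) ιO (galAdicCompletionMap (L := E) c hw) hιO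
    (injective_of_coe_eq_toPlace v w ιO hιO) (exists_map_eq_of_galAdicCompletionMap_eq v w c hc hw ιO hιO)
    (galAdicCompletionMap_toPlace c w w hw) (galAdicCompletionMap_galAdicCompletionMap_of_smul_eq c w hc hw)
    (mem_integer_galAdicCompletionMap c v w hw) (exists_isUnit_galAdicCompletionMap_sub c v hc hunr w hw)
    (fun x hx => mem_maximalIdeal_of_map_mem_maximalIdeal ιO x hx) (isUnit_two_integer_of_valued_eq_one w.1 h2) δ hδ hσδ
    (natCard_residueField_eq_natCard_residueField_sq c v hc hunr w hw) hϖE hn γ N hNpos hN hσγ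

end Composed

end Literature.NumberTheory.Automorphic

end
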